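import Summits.HodgeConjecture.CorCM.MultiFieldWeilUnitShapes
import HarnessLib

/-!
# MULTI-FIELD WEIL ENGINE — THE UNITS MENU BY SHAPES: finitely many CM fields `K_j ∋ k`, over each a list of pairwise non-isogenous structures of the menu — at most TWO per
# sextic field, at most THREE per `𝔄₄`/`𝔖₄`-octic field with every `(2,2)`-class separating every two `(1,3)`-classes, at most FOUR per decic field with the four types
# satisfying (H1)–(H2) — the Hodge conjecture for every product of copies of `E` and the structures, given only Markman's fourfold and hyperbolic-sixfold theorems

Cell `pub-hodgecm2` (COR-CM), seat b30 gen 40 (2026-08-26); count-neutral own lane MULTI-FIELD WEIL ENGINE (stem `MultiFieldWeil*`), the SHAPE form of the grouped headline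
`CorCM/MultiFieldWeilUnitsMenuGrouped.lean` (U7, `hodgeConjectureFor_biproduct_sigma_of_linearIndependent`): U7's linear-independence hypothesis `hli` (the centred type
indicators of every field with `≥ 3` structures independent over `ℚ`) is DISCHARGED from combinatorial conditions on the types over `τ`, by `CorCM/MultiFieldWeilUnitShapes.lean`
(one field: decic triples free, decic quadruples under (H1)–(H2), octic triples under separation) and `CorCM/MultiFieldWeilUnitGramFour.lean` (G1: the `185` quadruples; the rank
bound).  Theorems only; no definition, no named fact, no `sorry`.  HONEST FRAMING: conditional ONLY on the two displayed Markman binders; `HC_CM` is NOT proved and not asserted.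

**`hodgeConjectureFor_biproduct_sigma_of_shapes`.**  `k` imaginary quadratic with `τ`, `E ⊨ (k; {τ})`; `J` finite; CM fields `KJ j ⊇ iK j (k)` of degree `2·nJ j`; structures
`B j t ⊨ (KJ j; Ψ j t)`, `t : Fin (c j)`, with `(nJ j, p_{j,t}) ∈ {(3,1), (4,1), (4,2), (5,2)}` (`p` = members of `Ψ j t` over `τ`, types NORMALISED — replace a structure by its
complex conjugate otherwise); sextic `B j t` SIMPLE; `B j t ≁ B j t'` for `t ≠ t'`.  SHAPES: `c j ≤ 2` for sextic, `c j ≤ 3` for octic, `c j ≤ 4` for decic fields; over an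
octic field, whenever `Ψ j t₁`, `Ψ j t₂` (`t₁ ≠ t₂`) have ONE member over `τ` and `Ψ j t₃` has TWO, the latter contains the `τ`-member of exactly one of the former (`hsep`);
over a decic field with `c j = 4`: (H1) every type shares a `τ`-embedding with another one (`hmeet`) and (H2) some `τ`-embedding lies in `1`, `3` or `4` of the types (`hodd`).
Arithmetic: octic fields with a degree-`24` pair (quartic part `𝔄₄`/`𝔖₄`); decic fields with `c j ≥ 2` with a degree-`40` pair (`2`-transitive quintic part); `Hom(KJ j', KJ j)
= ∅` for `j ≠ j'` of equal degree; octic → sextic a value outside the closure.  THEN the Hodge conjecture holds for `⨁_l X_l`, every `X_l ∈ {E} ∪ {B j t}` (any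
multiplicities), GIVEN ONLY Markman's two theorems.

WHY THESE SHAPES ARE EVERYTHING THE METHOD GIVES (honest limits, all theorems): by the rank bound (G1 `fintype_card_lt_of_linearIndependent_cells`) independent centred
indicators on `n` letters number `≤ n − 1` — three sextic, four octic, five decic classes never separate; on four letters the only dependent triple of the menu is `{q}, {q'},
{q,q'}^{±}` (excluded by `hsep`); on five letters the dependent quadruples are exactly the `15` four-cycles and the `10` triangles with a disjoint edge (G1 §4), excluded by
(H1)–(H2).  Beyond: genuinely new Hodge classes (not in the span of the transported Weil classes), `(1,4)`-fivefolds, imprimitive quartic parts, fields not through `k`, HC_CM.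

PROOF.  U7 with `hli j` supplied by `linearIndependent_typeCells_of_three_octic` ∕ `…_of_three_pairs` ∕ `…_of_four_pairs`; distinct ∕ non-conjugate types of non-isogenous
structures by Shimura's criterion (`DihedralSexticPair.cmType_ne_and_ne_compl_of_not_isIsogenous`).

[cite: Markman2025SurveySecant, Thm. 1.2] [cite: Markman2025SecantWeil, Thm 1.5.1] [cite: Shimura1998, §6.1 Corollary of Theorem 2, §8.2 Prop. 26, §8.4, §18.2 Lemma (i)]
[cite: Deligne1982HodgeCycles, §5 (b)] [cite: Lang2002, VI §1 Thm. 1.14 and V §2 Thm. 2.8; XIII §4; XV §1] [cite: MoonenZarhin1995Duke, Thm. 2.4] [cite: Pohlmann1968, Thm 1]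
[cite: DixonMortimer1996, §1.4 Ex. 1.4.1–1.4.2; §1.6, Thm. 1.6A; §2.1; §3.3, Thm. 3.3A] [cite: Dodson1984, §1.1 Imprimitivity Theorem and §5.1.2 Theorem] [cite: MumfordAV1970, §19]

## References
* [Markman2025SurveySecant] E. Markman, arXiv:2509.23403, Thm. 1.2.  [Markman2025SecantWeil] E. Markman, Cycles on abelian 2n-folds of Weil type from secant sheaves on abelian
  n-folds, Thm 1.5.1.  [Shimura1998] G. Shimura, *Abelian varieties with complex multiplication and modular functions*, §6.1, §8.2, §8.4, §18.2.  [Deligne1982HodgeCycles]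
  P. Deligne, LNM 900, §5 (b).  [Lang2002] S. Lang, *Algebra*, GTM 211, V §2, VI §1, XIII §4, XV §1.  [MoonenZarhin1995Duke] B. Moonen, Yu. Zarhin, Duke Math. J. 77 (1995),
  Thm. 2.4.  [Pohlmann1968] H. Pohlmann, Ann. of Math. 88 (1968), Thm 1.  [DixonMortimer1996] J. D. Dixon, B. Mortimer, *Permutation Groups*, GTM 163.  [Dodson1984] B. Dodson,
  Trans. AMS 283 (1984).  [MumfordAV1970] D. Mumford, *Abelian Varieties*, §19.
-/

noncomputable section

open CategoryTheory CategoryTheory.Limits NumberField IntermediateField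

namespace Summit.HodgeConjecture.CorCM.MultiFieldWeil

open Finset
open Literature.AlgebraicGeometry Literature.AlgebraicGeometry.Motives Literature.AlgebraicGeometry.HodgeTheory
open Literature.AlgebraicGeometry.ComplexMultiplication (IsCMTypeRealisation)
open Literature.AlgebraicTopology.SingularHomology
open Literature.NumberTheory.ComplexMultiplication

open scoped Classical

section Shapes

variable {J : Type} [Fintype J] {KJ : J → Type} [fK : ∀ j, Field (KJ j)] [nK : ∀ j, NumberField (KJ j)] [cK : ∀ j, IsCMField (KJ j)]
  {k : Type} [fk : Field k] [nk : NumberField k] [ck : IsCMField k] {τ : k →+* ℂ} {c : J → ℕ}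
  {B : ∀ j : J, Fin (c j) → AbelianVariety ℂ} {Ψ : ∀ j : J, Fin (c j) → CMType (KJ j)}
  {ιB : ∀ (j : J) (t : Fin (c j)), 𝓞 (KJ j) →+* End (B j t)} {θB : ∀ (j : J) (t : Fin (c j)), KJ j →+* Module.End ℂ (complexBetti (B j t).X 1)}
  {E : AbelianVariety ℂ} {Φ₀ : CMType k} {ιE : 𝓞 k →+* End E} {θE : k →+* Module.End ℂ (complexBetti E.X 1)}

/-- **THE UNITS MENU BY SHAPES — GIVEN ONLY MARKMAN'S FOURFOLD AND HYPERBOLIC-SIXFOLD THEOREMS.**  See the module docstring.  `HC_CM` is NOT asserted.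
[cite: Markman2025SurveySecant, Thm. 1.2] [cite: Markman2025SecantWeil, Thm 1.5.1] [cite: Shimura1998, §6.1 Corollary of Theorem 2, §8.2 Prop. 26, §18.2]
[cite: Deligne1982HodgeCycles, §5 (b)] [cite: DixonMortimer1996, §1.4 Ex. 1.4.1–1.4.2; §1.6, Thm. 1.6A; §2.1] [cite: Dodson1984, §1.1 Imprimitivity Theorem and §5.1.2 Theorem]
[cite: Lang2002, XIII §4; XV §1] -/
theorem hodgeConjectureFor_biproduct_sigma_of_shapes (hW4 : Markman2025_weilClasses_algebraic_abelianFourfold)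
    (hM6 : Markman2025_weilClasses_algebraic_hyperbolicSixfold) (h2 : Module.finrank ℚ k = 2) (iK : ∀ j : J, k →+* KJ j) (nJ : J → ℕ)
    (hdeg : ∀ j, Module.finrank ℚ (KJ j) = 2 * nJ j) (hB : ∀ j t, IsCMTypeRealisation (Ψ j t) (B j t) (ιB j t) (θB j t))
    (hE : IsCMTypeRealisation Φ₀ E ιE θE) (hΦ₀ : ∀ σ : k →+* ℂ, σ ∈ Φ₀.1 ↔ σ = τ)
    (hS : ∀ j, nJ j = 3 → ∀ t, (B j t).IsSimple)
    (hcnt : ∀ j t, (nJ j = 3 ∧ (Finset.univ.filter fun s : KJ j →+* ℂ => s.comp (iK j) = τ ∧ s ∈ (Ψ j t).1).card = 1) ∨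
      (nJ j = 4 ∧ (Finset.univ.filter fun s : KJ j →+* ℂ => s.comp (iK j) = τ ∧ s ∈ (Ψ j t).1).card = 1) ∨
      (nJ j = 4 ∧ (Finset.univ.filter fun s : KJ j →+* ℂ => s.comp (iK j) = τ ∧ s ∈ (Ψ j t).1).card = 2) ∨
      (nJ j = 5 ∧ (Finset.univ.filter fun s : KJ j →+* ℂ => s.comp (iK j) = τ ∧ s ∈ (Ψ j t).1).card = 2))
    (hni : ∀ j t t', t ≠ t' → ¬ AbelianVariety.IsIsogenous (B j t) (B j t'))
    (hc3 : ∀ j, nJ j = 3 → c j ≤ 2) (hc4 : ∀ j, nJ j = 4 → c j ≤ 3) (hc5 : ∀ j, nJ j = 5 → c j ≤ 4)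
    (hsep : ∀ j, nJ j = 4 → ∀ t₁ t₂ t₃ : Fin (c j), t₁ ≠ t₂ → (Finset.univ.filter fun u : KJ j →+* ℂ => u.comp (iK j) = τ ∧ u ∈ (Ψ j t₁).1).card = 1 →
      (Finset.univ.filter fun u : KJ j →+* ℂ => u.comp (iK j) = τ ∧ u ∈ (Ψ j t₂).1).card = 1 →
      (Finset.univ.filter fun u : KJ j →+* ℂ => u.comp (iK j) = τ ∧ u ∈ (Ψ j t₃).1).card = 2 →
      ∀ s₁ s₂ : KJ j →+* ℂ, s₁.comp (iK j) = τ → s₂.comp (iK j) = τ → s₁ ∈ (Ψ j t₁).1 → s₂ ∈ (Ψ j t₂).1 → (s₁ ∈ (Ψ j t₃).1 ↔ s₂ ∉ (Ψ j t₃).1))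
    (hmeet : ∀ j, nJ j = 5 → c j = 4 → ∀ t : Fin (c j), ∃ t', t' ≠ t ∧ ∃ s : KJ j →+* ℂ, s.comp (iK j) = τ ∧ s ∈ (Ψ j t).1 ∧ s ∈ (Ψ j t').1)
    (hodd : ∀ j, nJ j = 5 → c j = 4 → ∃ s : KJ j →+* ℂ, s.comp (iK j) = τ ∧ (Finset.univ.filter fun t : Fin (c j) => s ∈ (Ψ j t).1).card ≠ 0 ∧
      (Finset.univ.filter fun t : Fin (c j) => s ∈ (Ψ j t).1).card ≠ 2)
    (h24 : ∀ j, nJ j = 4 → ∃ s₀ t₀ : KJ j →+* ℂ, s₀.comp (iK j) = τ ∧ t₀.comp (iK j) = τ ∧ s₀ ≠ t₀ ∧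
      Module.finrank ℚ ↥(adjoin ℚ (Set.range τ) ⊔ adjoin ℚ (Set.range s₀ ∪ Set.range t₀)) = 24)
    (h40 : ∀ j, nJ j = 5 → 1 < c j → ∃ s₀ t₀ : KJ j →+* ℂ, s₀.comp (iK j) = τ ∧ t₀.comp (iK j) = τ ∧ s₀ ≠ t₀ ∧
      Module.finrank ℚ ↥(adjoin ℚ (Set.range τ) ⊔ adjoin ℚ (Set.range s₀ ∪ Set.range t₀)) = 40)
    (hiso : ∀ j j' : J, j' ≠ j → nJ j = nJ j' → IsEmpty (KJ j' →+* KJ j))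
    (hout43 : ∀ j j' : J, nJ j = 4 → nJ j' = 3 → ∃ s : KJ j' →+* ℂ, s.comp (iK j') = τ ∧ ∃ x, s x ∉ normalClosure ℚ (KJ j) ℂ)
    {N : ℕ} (κ : Fin N → Option ((j : J) × Fin (c j))) :
    HodgeConjectureFor (⨁ fun l => ((κ l).elim E fun x => B x.1 x.2 : AbelianVariety ℂ)).dim (⨁ fun l => ((κ l).elim E fun x => B x.1 x.2 : AbelianVariety ℂ)).X := by
  -- distinct and non-conjugate types from non-isogeny (Shimura's criterion)
  have hne : ∀ j (t t' : Fin (c j)), t ≠ t' → (Ψ j t).1 ≠ (Ψ j t').1 ∧ (Ψ j t').1 ≠ (Ψ j t).1ᶜ := fun j t t' htt =>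
    DihedralSexticPair.cmType_ne_and_ne_compl_of_not_isIsogenous (hB j t) (hB j t') (hni j t t' htt)
  refine hodgeConjectureFor_biproduct_sigma_of_linearIndependent hW4 hM6 h2 iK nJ hdeg hB hE hΦ₀ hS hcnt hni (fun j hcj => ?_) h24 h40 hiso hout43 κ
  -- the independence hypothesis of U7 for a field with three or more structures, by shape
  have hcard : Fintype.card (Fin (c j)) = c j := Fintype.card_fin _
  obtain ⟨t₀⟩ : Nonempty (Fin (c j)) := ⟨⟨0, by omega⟩⟩
  rcases hcnt j t₀ with ⟨h3, -⟩ | ⟨h4, -⟩ | ⟨h4, -⟩ | ⟨h5, -⟩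
  · have := hc3 j h3; omega
  · have hc : c j = 3 := by have := hc4 j h4; omega
    exact linearIndependent_typeCells_of_three_octic h2 (iK j) (hdeg j) h4 τ (by rw [hcard, hc]) (Ψ j)
      (fun t => by rcases hcnt j t with ⟨h, -⟩ | ⟨-, h⟩ | ⟨-, h⟩ | ⟨h, -⟩ <;> omega) (hne j) (hsep j h4)
  · have hc : c j = 3 := by have := hc4 j h4; omega
    exact linearIndependent_typeCells_of_three_octic h2 (iK j) (hdeg j) h4 τ (by rw [hcard, hc]) (Ψ j)
      (fun t => by rcases hcnt j t with ⟨h, -⟩ | ⟨-, h⟩ | ⟨-, h⟩ | ⟨h, -⟩ <;> omega) (hne j) (hsep j h4)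
  · have hcnt5 : ∀ t : Fin (c j), (Finset.univ.filter fun u : KJ j →+* ℂ => u.comp (iK j) = τ ∧ u ∈ (Ψ j t).1).card = 2 := fun t => by
      rcases hcnt j t with ⟨h, -⟩ | ⟨h, -⟩ | ⟨h, -⟩ | ⟨-, h⟩
      · omega
      · omega
      · omega
      · exact h
    by_cases hc : c j = 3
    · exact linearIndependent_typeCells_of_three_pairs h2 (iK j) (hdeg j) h5 τ (by rw [hcard, hc]) (Ψ j) hcnt5 fun t t' htt => (hne j t t' htt).1
    · have hc' : c j = 4 := by have := hc5 j h5; omega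
      exact linearIndependent_typeCells_of_four_pairs h2 (iK j) (hdeg j) h5 τ (by rw [hcard, hc']) (Ψ j) hcnt5 (fun t t' htt => (hne j t t' htt).1)
        (hmeet j h5 hc') (hodd j h5 hc')

/-- **Dominated form**: every complex abelian variety dominated by such a product of copies (an isogeny factor, `s ≫ π = [N]`). [cite: Markman2025SurveySecant, Thm. 1.2]
[cite: Markman2025SecantWeil, Thm 1.5.1] [cite: MumfordAV1970, §19] -/
theorem hodgeConjectureFor_of_avDominatedBy_sigma_of_shapes (hW4 : Markman2025_weilClasses_algebraic_abelianFourfold)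
    (hM6 : Markman2025_weilClasses_algebraic_hyperbolicSixfold) (h2 : Module.finrank ℚ k = 2) (iK : ∀ j : J, k →+* KJ j) (nJ : J → ℕ)
    (hdeg : ∀ j, Module.finrank ℚ (KJ j) = 2 * nJ j) (hB : ∀ j t, IsCMTypeRealisation (Ψ j t) (B j t) (ιB j t) (θB j t))
    (hE : IsCMTypeRealisation Φ₀ E ιE θE) (hΦ₀ : ∀ σ : k →+* ℂ, σ ∈ Φ₀.1 ↔ σ = τ)
    (hS : ∀ j, nJ j = 3 → ∀ t, (B j t).IsSimple)
    (hcnt : ∀ j t, (nJ j = 3 ∧ (Finset.univ.filter fun s : KJ j →+* ℂ => s.comp (iK j) = τ ∧ s ∈ (Ψ j t).1).card = 1) ∨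
      (nJ j = 4 ∧ (Finset.univ.filter fun s : KJ j →+* ℂ => s.comp (iK j) = τ ∧ s ∈ (Ψ j t).1).card = 1) ∨
      (nJ j = 4 ∧ (Finset.univ.filter fun s : KJ j →+* ℂ => s.comp (iK j) = τ ∧ s ∈ (Ψ j t).1).card = 2) ∨
      (nJ j = 5 ∧ (Finset.univ.filter fun s : KJ j →+* ℂ => s.comp (iK j) = τ ∧ s ∈ (Ψ j t).1).card = 2))
    (hni : ∀ j t t', t ≠ t' → ¬ AbelianVariety.IsIsogenous (B j t) (B j t'))
    (hc3 : ∀ j, nJ j = 3 → c j ≤ 2) (hc4 : ∀ j, nJ j = 4 → c j ≤ 3) (hc5 : ∀ j, nJ j = 5 → c j ≤ 4)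
    (hsep : ∀ j, nJ j = 4 → ∀ t₁ t₂ t₃ : Fin (c j), t₁ ≠ t₂ → (Finset.univ.filter fun u : KJ j →+* ℂ => u.comp (iK j) = τ ∧ u ∈ (Ψ j t₁).1).card = 1 →
      (Finset.univ.filter fun u : KJ j →+* ℂ => u.comp (iK j) = τ ∧ u ∈ (Ψ j t₂).1).card = 1 →
      (Finset.univ.filter fun u : KJ j →+* ℂ => u.comp (iK j) = τ ∧ u ∈ (Ψ j t₃).1).card = 2 →
      ∀ s₁ s₂ : KJ j →+* ℂ, s₁.comp (iK j) = τ → s₂.comp (iK j) = τ → s₁ ∈ (Ψ j t₁).1 → s₂ ∈ (Ψ j t₂).1 → (s₁ ∈ (Ψ j t₃).1 ↔ s₂ ∉ (Ψ j t₃).1))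
    (hmeet : ∀ j, nJ j = 5 → c j = 4 → ∀ t : Fin (c j), ∃ t', t' ≠ t ∧ ∃ s : KJ j →+* ℂ, s.comp (iK j) = τ ∧ s ∈ (Ψ j t).1 ∧ s ∈ (Ψ j t').1)
    (hodd : ∀ j, nJ j = 5 → c j = 4 → ∃ s : KJ j →+* ℂ, s.comp (iK j) = τ ∧ (Finset.univ.filter fun t : Fin (c j) => s ∈ (Ψ j t).1).card ≠ 0 ∧
      (Finset.univ.filter fun t : Fin (c j) => s ∈ (Ψ j t).1).card ≠ 2)
    (h24 : ∀ j, nJ j = 4 → ∃ s₀ t₀ : KJ j →+* ℂ, s₀.comp (iK j) = τ ∧ t₀.comp (iK j) = τ ∧ s₀ ≠ t₀ ∧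
      Module.finrank ℚ ↥(adjoin ℚ (Set.range τ) ⊔ adjoin ℚ (Set.range s₀ ∪ Set.range t₀)) = 24)
    (h40 : ∀ j, nJ j = 5 → 1 < c j → ∃ s₀ t₀ : KJ j →+* ℂ, s₀.comp (iK j) = τ ∧ t₀.comp (iK j) = τ ∧ s₀ ≠ t₀ ∧
      Module.finrank ℚ ↥(adjoin ℚ (Set.range τ) ⊔ adjoin ℚ (Set.range s₀ ∪ Set.range t₀)) = 40)
    (hiso : ∀ j j' : J, j' ≠ j → nJ j = nJ j' → IsEmpty (KJ j' →+* KJ j))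
    (hout43 : ∀ j j' : J, nJ j = 4 → nJ j' = 3 → ∃ s : KJ j' →+* ℂ, s.comp (iK j') = τ ∧ ∃ x, s x ∉ normalClosure ℚ (KJ j) ℂ)
    {N : ℕ} (κ : Fin N → Option ((j : J) × Fin (c j))) {X : AbelianVariety ℂ}
    (hX : Domination.AVDominatedBy X (⨁ fun l => ((κ l).elim E fun x => B x.1 x.2 : AbelianVariety ℂ))) : HodgeConjectureFor X.dim X.X :=
  Domination.hodgeConjectureFor_of_avDominatedBy
    (hodgeConjectureFor_biproduct_sigma_of_shapes hW4 hM6 h2 iK nJ hdeg hB hE hΦ₀ hS hcnt hni hc3 hc4 hc5 hsep hmeet hodd h24 h40 hiso hout43 κ) hX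

end Shapes

end Summit.HodgeConjecture.CorCM.MultiFieldWeil

end
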